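import Literature.AnabelianGeometry.EtaleTheta.Discharge.Sec2ModelKummerLifting
import Literature.AnabelianGeometry.EtaleTheta.Discharge.Sec2Cor218iThetaSubquotients
import Literature.AnabelianGeometry.EtaleTheta.Discharge.Sec2Cor218iModel
import HarnessLib

/-!
# [EtTh] Cor 2.18 (i) for the §1 → §2 rigidity data: the `L`-free core that Cor 2.19 (i) consumes,
# and the cusp-LABEL clause, which is unsatisfiable at some labelling (proof-only; FROZEN FACT-LIST
# rows F-0620 (hypothesis census), F-0626, F-0627)

Mochizuki, *The étale theta function and its Frobenioid-theoretic manifestations*, Publ. RIMS **45**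
(2009) [EtTh], §2: Cor. 2.18 (i) PRIMS PDF p. 60, Cor. 2.18 (iii) p. 61, Cor. 2.19 (i) p. 64, proof of
2.19 (i) pp. 65–66 [cite: MochizukiEtTh2009, Cor 2.18 (i) p.60].  Cell `abc-iut`, block F, seat
abc-iut-f-148 (gen 2; F-TRANCHES tranche 148 = F-0627/F-0628/F-0629/F-0630 of D-0078 (S1)).
PROOF-ONLY: no definition, no instance, nothing of another seat edited or restated.

STATE OF RECORD.  Over the lawless interface `RigidData N l` (`ThetaRigidity.lean`) the universal
closures of the [EtTh] §2 rows are REFUTED at explicit toys (abc-iut-w5-d175,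
`ThetaRigiditySchemaWitness.lean`), so the rows are consumable AT A NAMED INSTANCE only; the instance
the cone consumes is abc-iut-L2-t8's adapter `C.rigidData μ hC hS h15 L` (`RigidOfSetting.lean`) over a
theta setting `D`, an étale-theta datum `E`, a choice `X̲̲` (`C`), a level-`N` identification `μ` and
cusp LABELS `L : C.CuspLabels` (a record with NO law tying labels to cuspidal decomposition groups —
abc-iut-L2-d1's `Sec2CuspLabelsNV.lean`).  Lane C2 (abc-iut-L2-d1, `Sec2CyclotomicRigidityProofs.lean`)
proves `Cor219_i_subquotients` (F-0627) / `Cor219_i_splittings` (F-0626) from the named facts `Cor218_i`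
(F-0620, FACT-policy: the anabelian input, SIX invariance clauses for every topological automorphism
`γ` of `Π^tp_X̲̲`), `Cor218_iii_quotient`/`_PiX` (⟸ temp-slimness) and `Prop214_i`.

THIS FILE (hypothesis census of that reduction, in the kernel, and its consequence for the binder).
§1 (any `R : RigidData N l`): Cor. 2.19 (i) consumes ONLY the three clauses `Δ`,
`Ker(Π^tp_X̲̲ → (Π^tp_X)^Θ)`, `l·Δ_Θ` of `Cor218_i` — abc-iut-L2-d1's `exists_gamma_of_cor218` re-threaded
on what it uses (`exists_gamma_of_core`, `cor219_i_subquotients_of_core`, `cor219_i_splittings_of_core`,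
`cor219_i_of_core_tempSlim`); the clauses `Π•_Y`, `Π•_Ÿ` and the cusp-LABEL clause are idle there.
§2 (the adapter over any theta setting `D`): (a) **whenever `Π^tp_X` is temp-slim, the label clause of
`Cor218_i` is UNSATISFIABLE at some labelling**: `¬ ∀ L, (C.rigidData μ hC hS h15 L).Cor218_i`
(`exists_cuspLabels_not_cor218_i_of_slim`, `not_forall_cuspLabels_cor218_i_of_slim`).  Witness: every
label `↦ {⟨g⟩}` for a `g ∈ Π^tp_X̲̲` with `toZ g = l` (a generator of `Gal(Y̲̲/X̲̲) ≅ l·ℤ`); `⟨g⟩` is moved by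
an inner (bi-continuous) automorphism of `Π^tp_X̲̲`, since `x ⟨g⟩ x⁻¹ = ⟨g⟩` forces `x g x⁻¹ = g` (apply
`toZ`) and `g` central in the OPEN subgroup `Π^tp_X̲̲` contradicts slimness.  CONSEQUENCE for consumers: a
theorem binding `h218i : (C.rigidData μ hC hS h15 L).Cor218_i` at an ARBITRARY `L` is vacuous at such
`L`; bind it at labellings whose classes are `Aut_top(Π^tp_X̲̲)`-stable (print: "label ↦ the conjugacy
class of cuspidal decomposition groups", Cor. 2.9 p. 43), or bind the `L`-free core, which is all that
Cor. 2.19 (i) consumes (`cor218_i_emptyLabels_iff`: at the empty labelling `Cor218_i` IS its five `L`-free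
clauses).  (b) The core at the adapter from "every `γ ∈ Aut_top(Π^tp_X̲̲)` extends to a
`Δ^tp_X`-stabilising `Γ ∈ Aut_top(Π^tp_X)`" — abc-iut-L2-d1's `rigidData_*_map_eq_of_extends` WITHOUT the
`Π^tp_Ÿ`-stabilisation and label clauses of `rigidData_cor218_i_of_extends` (`rigidData_core_of_extends`,
`rigidData_cor219_i_of_extends`).  (c) The `Π•_Y`-clause from COMPACTNESS of `Π^tp_Y` alone
(`rigidData_map_PiY_eq_of_isCompact_GtpY`, via abc-iut-L6-d6's `rigidData_map_PiY_eq_of_compactlyGenerated`).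
The companion `Sec2Cor219iAtModelChi.lean` instantiates all of this AT THE RECORD MODEL `ThetaSetting.modelχ p`.

HONEST FRAMING: a kernel census of which clauses of a FACT-policy row its consumers use, plus a
satisfiability finding about the typed label record; F-0620 stays a FACT-policy row of the cell (the
anabelian input is NOT claimed); nothing of [EtTh] (refereed) is asserted or disputed; no side is taken
on [IUTchIII] Cor. 3.12; typed ≠ proved; a FACT row is an assumption label, not an endorsement.
-/

noncomputable section

namespace Literature.AnabelianGeometry.EtaleTheta

open Literature.AlgebraicGeometry.Frobenioids (IsSlimGroup)

universe u

/-! ## §1. Cor 2.19 (i) consumes only the `L`-free core of `Cor218_i` (any `RigidData`) -/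

namespace RigidData

variable {N : ℕ+} {l : ℕ} (R : RigidData.{u} N l)

/-- The three clauses of `Cor218_i` that Cor. 2.19 (i) consumes — `Δ`, `Ker(Π^tp_X̲̲ → (Π^tp_X)^Θ)`,
`l·Δ_Θ` invariant under every topological automorphism `γ` of `Π^tp_X̲̲` — follow from `Cor218_i`
(projection to clauses 3–5 of 6). [cite: MochizukiEtTh2009, Cor 2.18 (i) p.60] -/
theorem core_of_cor218_i (h : R.Cor218_i) (γ : R.PiX ≃ₜ* R.PiX) :
    R.aug.ker.map γ.toMulEquiv.toMonoidHom = R.aug.ker ∧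
      R.thetaKer.map γ.toMulEquiv.toMonoidHom = R.thetaKer ∧
      R.lDeltaTheta.map γ.toMulEquiv.toMonoidHom = R.lDeltaTheta :=
  let ⟨_, _, hΔ, hK, hL, _⟩ := h γ
  ⟨hΔ, hK, hL⟩

/-- From the `L`-free core of Cor. 2.18 (i) and Cor. 2.18 (iii), every automorphism of the model
`M(η)` lies over a topological automorphism `γ` of `Π^tp_X̲̲` preserving `Δ`, `Ker(↠Θ)` and `l·Δ_Θ` —
abc-iut-L2-d1's `exists_gamma_of_cor218` re-threaded on the three clauses it actually uses.
[cite: MochizukiEtTh2009, Cor 2.19 (i) p.65] -/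
theorem exists_gamma_of_core
    (hcore : ∀ γ : R.PiX ≃ₜ* R.PiX, R.aug.ker.map γ.toMulEquiv.toMonoidHom = R.aug.ker ∧
      R.thetaKer.map γ.toMulEquiv.toMonoidHom = R.thetaKer ∧
      R.lDeltaTheta.map γ.toMulEquiv.toMonoidHom = R.lDeltaTheta)
    (h218q : R.Cor218_iii_quotient) (h218P : R.Cor218_iii_PiX) {η : R.PiYdd → R.mu}
    {hη : η ∈ R.thetaCocycles} (α : (R.modelMono hη).Iso (R.modelMono hη)) :
    ∃ γ : R.PiX ≃ₜ* R.PiX, (∀ x : R.env, ((α.e x).right : R.PiX) = γ (x.right : R.PiX)) ∧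
      R.aug.ker.map γ.toMulEquiv.toMonoidHom = R.aug.ker ∧
      R.thetaKer.map γ.toMulEquiv.toMonoidHom = R.thetaKer ∧
      R.lDeltaTheta.map γ.toMulEquiv.toMonoidHom = R.lDeltaTheta := by
  have hker : ((CycEnvelope.proj R.augY R.chi).ker).map α.e.toMulEquiv.toMonoidHom =
      (CycEnvelope.proj R.augY R.chi).ker := by
    have h := h218q
    unfold Cor218_iii_quotient at h
    rw [← h]
    exact map_centralizerUnion_eq α.e
  obtain ⟨γ, hγ⟩ := ThetaEnvData.exists_continuousMulEquiv_PiX_of_iso α hker h218P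
  exact ⟨γ, hγ, hcore γ⟩

/-- **Cor. 2.19 (i), subquotients, from the `L`-free core of Cor. 2.18 (i) and Cor. 2.18 (iii)** — the
row F-0627 for `R` with the `Π•_Y`-, `Π•_Ÿ`- and cusp-label clauses of F-0620 NOT consumed.
[cite: MochizukiEtTh2009, Cor 2.19 (i) p.64] -/
theorem cor219_i_subquotients_of_core
    (hcore : ∀ γ : R.PiX ≃ₜ* R.PiX, R.aug.ker.map γ.toMulEquiv.toMonoidHom = R.aug.ker ∧
      R.thetaKer.map γ.toMulEquiv.toMonoidHom = R.thetaKer ∧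
      R.lDeltaTheta.map γ.toMulEquiv.toMonoidHom = R.lDeltaTheta)
    (h218q : R.Cor218_iii_quotient) (h218P : R.Cor218_iii_PiX) : R.Cor219_i_subquotients := by
  intro η hη α
  obtain ⟨γ, hγ, hΔ, hK, hL⟩ := R.exists_gamma_of_core hcore h218q h218P α
  refine ⟨?_, ?_, ?_⟩
  · rw [R.algImage_eq_thetaImage hη R.thetaKer (R.cocycle_thetaKer η hη)]
    exact R.map_thetaImage_eq α γ hγ R.thetaKer hK (le_trans R.thetaKer_le inf_le_right)
  · rw [R.algImage_sup_ker_eq R.lDeltaTheta (le_trans R.lDeltaTheta_le inf_le_left)]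
    exact R.toThetaEnvData.map_comap_right_eq α.e.toMulEquiv γ hγ R.lDeltaTheta hL
  · rw [R.toThetaEnvData.deltaEnv_eq_comap]
    exact R.toThetaEnvData.map_comap_right_eq α.e.toMulEquiv γ hγ R.aug.ker hΔ

/-- **Cor. 2.19 (i), the two splittings, from the `L`-free core of Cor. 2.18 (i), Cor. 2.18 (iii) and
Prop. 2.14 (i)** — the row F-0626 for `R` with the `Π•_Y`-, `Π•_Ÿ`- and cusp-label clauses of F-0620 NOT
consumed. [cite: MochizukiEtTh2009, Cor 2.19 (i) p.64] -/
theorem cor219_i_splittings_of_core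
    (hcore : ∀ γ : R.PiX ≃ₜ* R.PiX, R.aug.ker.map γ.toMulEquiv.toMonoidHom = R.aug.ker ∧
      R.thetaKer.map γ.toMulEquiv.toMonoidHom = R.thetaKer ∧
      R.lDeltaTheta.map γ.toMulEquiv.toMonoidHom = R.lDeltaTheta)
    (h218q : R.Cor218_iii_quotient) (h218P : R.Cor218_iii_PiX) (h214i : R.Prop214_i) :
    R.Cor219_i_splittings := by
  intro η hη α
  obtain ⟨γ, hγ, -, -, hL⟩ := R.exists_gamma_of_core hcore h218q h218P α
  obtain ⟨hK', -, hΔ'⟩ := R.cor219_i_subquotients_of_core hcore h218q h218P η hη α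
  have hD : R.DY.map (TopOut.transport α.e) = R.DY := α.map_D
  refine ⟨le_antisymm (R.map_algImage_lDeltaTheta_le h214i α.e hD hΔ' hK') ?_,
    R.map_thetaImage_eq α γ hγ R.lDeltaTheta hL (le_trans R.lDeltaTheta_le inf_le_right)⟩
  exact R.toThetaEnvData.le_map_of_map_symm_le α.e _ (R.map_algImage_lDeltaTheta_le h214i
    α.e.symm (R.toThetaEnvData.iso_map_D_symm α) (R.toThetaEnvData.map_symm_eq_of_map_eq α.e _ hΔ')
    (R.toThetaEnvData.map_symm_eq_of_map_eq α.e _ hK'))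

/-- The core being all that is consumed, the two rows follow from it under TEMP-SLIMNESS of `Π^tp_X̲̲`
(Cor. 2.18 (iii) ⟸ slimness, abc-iut-L2-d1's `cor218_iii_of_tempSlim`).
[cite: MochizukiEtTh2009, Cor 2.19 (i) p.64] -/
theorem cor219_i_of_core_tempSlim
    (hcore : ∀ γ : R.PiX ≃ₜ* R.PiX, R.aug.ker.map γ.toMulEquiv.toMonoidHom = R.aug.ker ∧
      R.thetaKer.map γ.toMulEquiv.toMonoidHom = R.thetaKer ∧
      R.lDeltaTheta.map γ.toMulEquiv.toMonoidHom = R.lDeltaTheta)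
    (hts : ∀ U : Subgroup R.PiX, IsOpen (U : Set R.PiX) →
      ∀ z : R.PiX, (∀ u ∈ U, z * u = u * z) → z = 1) :
    R.Cor219_i_subquotients ∧ (R.Prop214_i → R.Cor219_i_splittings) :=
  ⟨R.cor219_i_subquotients_of_core hcore (R.cor218_iii_of_tempSlim hts).2
      (R.cor218_iii_of_tempSlim hts).1,
    fun h214i => R.cor219_i_splittings_of_core hcore (R.cor218_iii_of_tempSlim hts).2
      (R.cor218_iii_of_tempSlim hts).1 h214i⟩

end RigidData

/-! ## §2. The adapter `C.rigidData μ hC hS h15 L` over a theta setting `D` -/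

namespace ThetaSetting.EtaleThetaData.DoubleUnderline

open Literature.AnabelianGeometry.SemiGraphs

variable {p : ℕ} [Fact p.Prime] {D : ThetaSetting p} {E : D.EtaleThetaData} {l : ℕ}
  (C : E.DoubleUnderline l) {N : ℕ+} (μ : D.CyclotomeMod l N) (hC : D.Compat) (hS : D.Sec2Hyps)
  (h15 : Prop15iii E hC)

/-- **The cusp-LABEL clause of `Cor218_i` at the adapter is unsatisfiable at some labelling, whenever
`Π^tp_X` is temp-slim**: there is `L : C.CuspLabels` with `¬ (C.rigidData μ hC hS h15 L).Cor218_i`.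
Witness: every label `↦ {⟨g⟩}` for a `g ∈ Π^tp_X̲̲` with `toZ g = l` (a generator of `Gal(Y̲̲/X̲̲)`); the
cyclic subgroup `⟨g⟩` is NOT normal in `Π^tp_X̲̲` (`x ⟨g⟩ x⁻¹ = ⟨g⟩` forces `x g x⁻¹ = g` by applying
`toZ`, and `g` central in the open `Π^tp_X̲̲` contradicts slimness), so the inner automorphism by some
`x ∈ Π^tp_X̲̲` moves the label class.  (The record `CuspLabels` carries no law tying the labels to cuspidal
decomposition groups — abc-iut-L2-d1's `Sec2CuspLabelsNV.lean`; print: "label ↦ the conjugacy class of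
cuspidal decomposition groups", Cor. 2.9 p. 43.) [cite: MochizukiEtTh2009, Cor 2.18 (i) p.60] -/
theorem exists_cuspLabels_not_cor218_i_of_slim (hslim : IsSlimGroup D.PiTemp) :
    ∃ L : C.CuspLabels, ¬ (C.rigidData μ hC hS h15 L).Cor218_i := by
  classical
  have hl : (l : ℤ) ≠ 0 := Int.natCast_ne_zero.mpr C.l_ne_zero
  -- a generator of `Gal(Y̲̲/X̲̲)`: `g ∈ Π^tp_X̲̲` with `toZ g = l`
  obtain ⟨g, hg, hgz⟩ : ∃ g ∈ C.Huu, D.toZ g = Multiplicative.ofAdd (l : ℤ) := by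
    have h := Subgroup.mem_zpowers (Multiplicative.ofAdd (l : ℤ))
    rw [← C.map_toZ_Huu, Subgroup.mem_map] at h
    exact h
  let g' : C.Huu := ⟨g, hg⟩
  -- `g` is not central in the open subgroup `Π^tp_X̲̲` (temp-slimness of `Π^tp_X`)
  obtain ⟨x', hx'⟩ : ∃ x' : C.Huu, x' * g' ≠ g' * x' := by
    by_contra h
    push Not at h
    have hmem : g ∈ Subgroup.centralizer (C.Huu : Set D.PiTemp) := by
      rw [Subgroup.mem_centralizer_iff]
      intro y hy
      exact congrArg Subtype.val (h ⟨y, hy⟩)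
    rw [hslim.centralizer_eq_bot C.Huu C.isOpen_Huu, Subgroup.mem_bot] at hmem
    rw [hmem, map_one] at hgz
    have h0 := congrArg Multiplicative.toAdd hgz
    rw [toAdd_one, toAdd_ofAdd] at h0
    exact hl h0.symm
  -- the perverse labelling: every label ↦ `{⟨g⟩}`
  refine ⟨⟨fun _ => ∅, fun _ => {Subgroup.zpowers g'}, fun _ => rfl⟩, fun h218 => hx' ?_⟩
  -- conjugation by `x'`, a bi-continuous automorphism of `Π^tp_X̲̲`
  let γ : C.Huu ≃ₜ* C.Huu :=
    { MulAut.conj x' with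
      continuous_toFun := by
        show Continuous fun h : C.Huu => x' * h * x'⁻¹
        fun_prop
      continuous_invFun := by
        show Continuous fun h : C.Huu => x'⁻¹ * h * x'
        fun_prop }
  have hγ : ∀ h : C.Huu, γ.toMulEquiv.toMonoidHom h = x' * h * x'⁻¹ := fun _ => rfl
  obtain ⟨-, -, -, -, -, hcusp⟩ := h218 γ
  have h0 := hcusp 0
  change (fun H : Subgroup C.Huu => H.map γ.toMulEquiv.toMonoidHom) '' {Subgroup.zpowers g'} =
    {Subgroup.zpowers g'} at h0
  rw [Set.image_singleton, Set.singleton_eq_singleton_iff, MonoidHom.map_zpowers] at h0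
  have hmem : γ.toMulEquiv.toMonoidHom g' ∈ Subgroup.zpowers g' := by
    rw [← h0]
    exact Subgroup.mem_zpowers _
  obtain ⟨k, hk⟩ := Subgroup.mem_zpowers_iff.mp hmem
  rw [hγ] at hk
  -- apply `toZ`: `l·k = l`, so `k = 1`
  let φ : C.Huu →* Multiplicative ℤ := D.toZ.comp C.Huu.subtype
  have hφg : φ g' = Multiplicative.ofAdd (l : ℤ) := hgz
  have hz := congrArg φ hk
  rw [map_zpow, map_mul, map_mul, map_inv, mul_comm (φ x') (φ g'), mul_inv_cancel_right, hφg,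
    ← ofAdd_zsmul, smul_eq_mul] at hz
  have hz' : k * (l : ℤ) = l := Multiplicative.ofAdd.injective hz
  have hk1 : k = 1 := by
    have h1 : (k - 1) * (l : ℤ) = 0 := by rw [sub_mul, one_mul, hz', sub_self]
    rcases mul_eq_zero.mp h1 with h | h
    · exact (sub_eq_zero.mp h)
    · exact absurd h hl
  rw [hk1, zpow_one] at hk
  -- `g' = x' g' x'⁻¹`
  calc x' * g' = x' * g' * x'⁻¹ * x' := by group
    _ = g' * x' := by rw [← hk]

/-- **`¬ ∀ L, Cor218_i`** at the adapter under temp-slimness of `Π^tp_X`: the instance form of F-0620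
cannot be a theorem uniformly in the labels `L`; consumers bind it at labellings whose classes are
`Aut_top(Π^tp_X̲̲)`-stable, or bind the `L`-free core (§1). [cite: MochizukiEtTh2009, Cor 2.18 (i) p.60] -/
theorem not_forall_cuspLabels_cor218_i_of_slim (hslim : IsSlimGroup D.PiTemp) :
    ¬ ∀ L : C.CuspLabels, (C.rigidData μ hC hS h15 L).Cor218_i := by
  obtain ⟨L, hL⟩ := C.exists_cuspLabels_not_cor218_i_of_slim μ hC hS h15 hslim
  exact fun h => hL (h L)

/-- At the EMPTY labelling the label clause is trivially true, so `Cor218_i` there is exactly its five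
`L`-free clauses. [cite: MochizukiEtTh2009, Cor 2.18 (i) p.60] -/
theorem cor218_i_emptyLabels_iff :
    (C.rigidData μ hC hS h15 ⟨fun _ => ∅, fun _ => ∅, fun _ => rfl⟩).Cor218_i ↔
      ∀ γ : ↥C.Huu ≃ₜ* ↥C.Huu,
        (C.rigidData μ hC hS h15 ⟨fun _ => ∅, fun _ => ∅, fun _ => rfl⟩).PiY.map
            γ.toMulEquiv.toMonoidHom =
          (C.rigidData μ hC hS h15 ⟨fun _ => ∅, fun _ => ∅, fun _ => rfl⟩).PiY ∧
        (C.rigidData μ hC hS h15 ⟨fun _ => ∅, fun _ => ∅, fun _ => rfl⟩).PiYdd.map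
            γ.toMulEquiv.toMonoidHom =
          (C.rigidData μ hC hS h15 ⟨fun _ => ∅, fun _ => ∅, fun _ => rfl⟩).PiYdd ∧
        (C.rigidData μ hC hS h15 ⟨fun _ => ∅, fun _ => ∅, fun _ => rfl⟩).aug.ker.map
            γ.toMulEquiv.toMonoidHom =
          (C.rigidData μ hC hS h15 ⟨fun _ => ∅, fun _ => ∅, fun _ => rfl⟩).aug.ker ∧
        (C.rigidData μ hC hS h15 ⟨fun _ => ∅, fun _ => ∅, fun _ => rfl⟩).thetaKer.map
            γ.toMulEquiv.toMonoidHom =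
          (C.rigidData μ hC hS h15 ⟨fun _ => ∅, fun _ => ∅, fun _ => rfl⟩).thetaKer ∧
        (C.rigidData μ hC hS h15 ⟨fun _ => ∅, fun _ => ∅, fun _ => rfl⟩).lDeltaTheta.map
            γ.toMulEquiv.toMonoidHom =
          (C.rigidData μ hC hS h15 ⟨fun _ => ∅, fun _ => ∅, fun _ => rfl⟩).lDeltaTheta := by
  refine ⟨fun h γ => ?_, fun h γ => ?_⟩
  · obtain ⟨h1, h2, h3, h4, h5, -⟩ := h γ
    exact ⟨h1, h2, h3, h4, h5⟩
  · obtain ⟨h1, h2, h3, h4, h5⟩ := h γ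
    refine ⟨h1, h2, h3, h4, h5, fun a => ?_⟩
    change (fun H : Subgroup C.Huu => H.map γ.toMulEquiv.toMonoidHom) '' ∅ = ∅
    exact Set.image_empty _

/-- **The `L`-free core of Cor. 2.18 (i) at the adapter from extension to a `Δ`-stabilising
automorphism of `Π^tp_X`** — abc-iut-L2-d1's three `rigidData_*_map_eq_of_extends`, without the
`Π^tp_Ÿ`-stabilisation and without the label clause of `rigidData_cor218_i_of_extends`.
[cite: MochizukiEtTh2009, Cor 2.18 (i) p.60] -/
theorem rigidData_core_of_extends (L : C.CuspLabels)
    (hext : ∀ γ : ↥C.Huu ≃ₜ* ↥C.Huu, ∃ Γ : D.PiTemp ≃ₜ* D.PiTemp,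
      (∀ h : C.Huu, Γ (h : D.PiTemp) = ((γ h : C.Huu) : D.PiTemp)) ∧
      D.DeltaTemp.map Γ.toMulEquiv.toMonoidHom = D.DeltaTemp)
    (γ : ↥C.Huu ≃ₜ* ↥C.Huu) :
    (C.rigidData μ hC hS h15 L).aug.ker.map γ.toMulEquiv.toMonoidHom =
        (C.rigidData μ hC hS h15 L).aug.ker ∧
      (C.rigidData μ hC hS h15 L).thetaKer.map γ.toMulEquiv.toMonoidHom =
        (C.rigidData μ hC hS h15 L).thetaKer ∧
      (C.rigidData μ hC hS h15 L).lDeltaTheta.map γ.toMulEquiv.toMonoidHom =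
        (C.rigidData μ hC hS h15 L).lDeltaTheta := by
  obtain ⟨Γ, hΓ, hΔ⟩ := hext γ
  exact ⟨C.rigidData_augKer_map_eq_of_extends μ hC hS h15 L γ Γ hΓ hΔ,
    C.rigidData_thetaKer_map_eq_of_extends μ hC hS h15 L γ Γ hΓ hΔ,
    C.rigidData_lDeltaTheta_map_eq_of_extends μ hC hS h15 L γ Γ hΓ hΔ⟩

/-- **Cor. 2.19 (i) (both rows F-0627, F-0626) at the adapter from: extension of every `γ` to a
`Δ`-stabilising `Γ`, temp-slimness of `Π^tp_X`, and (for the splittings) Prop. 2.14 (i)** — no clause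
about `Π^tp_Ÿ` or the labels. [cite: MochizukiEtTh2009, Cor 2.19 (i) p.64] -/
theorem rigidData_cor219_i_of_extends (L : C.CuspLabels)
    (hext : ∀ γ : ↥C.Huu ≃ₜ* ↥C.Huu, ∃ Γ : D.PiTemp ≃ₜ* D.PiTemp,
      (∀ h : C.Huu, Γ (h : D.PiTemp) = ((γ h : C.Huu) : D.PiTemp)) ∧
      D.DeltaTemp.map Γ.toMulEquiv.toMonoidHom = D.DeltaTemp)
    (hslim : IsSlimGroup D.PiTemp) :
    (C.rigidData μ hC hS h15 L).Cor219_i_subquotients ∧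
      ((C.rigidData μ hC hS h15 L).Prop214_i → (C.rigidData μ hC hS h15 L).Cor219_i_splittings) :=
  (C.rigidData μ hC hS h15 L).cor219_i_of_core_tempSlim (C.rigidData_core_of_extends μ hC hS h15 L hext)
    (C.tempSlim_Huu hslim)

/-- **The `Π•_Y`-clause of Cor. 2.18 (i) at the adapter from COMPACTNESS of `Π^tp_Y` alone**: a compact
`Π^tp_Y` meets the open (hence closed) `Π^tp_X̲̲` in a compact subgroup `Π^tp_Y̲̲` of `Π^tp_X̲̲`, which is
then trivially "topologically generated by compact subgroups" (abc-iut-L6-d6's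
`rigidData_map_PiY_eq_of_compactlyGenerated`). [cite: MochizukiEtTh2009, Cor 2.18 (i) p.60] -/
theorem rigidData_map_PiY_eq_of_isCompact_GtpY (L : C.CuspLabels)
    (hcpt : IsCompact (D.GtpY : Set D.PiTemp)) (γ : ↥C.Huu ≃ₜ* ↥C.Huu) :
    (C.rigidData μ hC hS h15 L).PiY.map γ.toMulEquiv.toMonoidHom = (C.rigidData μ hC hS h15 L).PiY := by
  refine C.rigidData_map_PiY_eq_of_compactlyGenerated μ hC hS h15 L ?_ γ
  have hK : IsCompact ((D.GtpY.subgroupOf C.Huu : Subgroup C.Huu) : Set C.Huu) := by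
    refine Topology.IsInducing.subtypeVal.isCompact_iff.mpr ?_
    convert hcpt.inter_right (C.Huu.isClosed_of_isOpen C.isOpen_Huu) using 1
    ext y
    constructor
    · rintro ⟨h, hh, rfl⟩
      exact ⟨Subgroup.mem_subgroupOf.mp hh, h.2⟩
    · rintro ⟨hy, hyH⟩
      exact ⟨⟨y, hyH⟩, Subgroup.mem_subgroupOf.mpr hy, rfl⟩
  intro h hh
  exact Subgroup.le_topologicalClosure _ (Subgroup.subset_closure ⟨_, hK, hh⟩)

end ThetaSetting.EtaleThetaData.DoubleUnderline

end Literature.AnabelianGeometry.EtaleTheta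

end
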